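import Mathlib
import HarnessLib
import Literature.Computability.ImplicitComplexity.SoftTypeAssignment
import Literature.Computability.ImplicitComplexity.SoftTypeAssignmentWords
import Literature.Computability.ImplicitComplexity.ObsessionalCliques
import Literature.Computability.ImplicitComplexity.CliqueDecides
import Literature.Computability.ImplicitComplexity.ObsessionalCliqueSaturation

/-!
# The relational interpretation of soft programs (`SoftProgramInterpretation`)

The link between the landed CALCULUS `STA`/`STA₊` (`SoftTypeAssignment`: `STA.Typing`, `STA.progTy`,
`SoftRepresentsAtLevel`) and the landed MODEL (`ObsessionalCliques`: the untyped relational space `D` of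
Laurent–Tortora de Falco (= LTdF) `URel.Point`, the `t`-action of `(ℕ*, ·)`, `URel.IsObsessional`,
`URel.ObsessionalFrom`; `CliqueDecides`: the word→boolean interface), which `CliqueDecides.lean` defers
explicitly: the interpretation `⟦Π⟧ ⊆ D` of a typing DERIVATION `Π ▹ Γ ⊢ M : σ` of `STA₊`, and in particular of
a closed program `⊢ M : !ⁿ S_m ⊸ B`, as a clique of points of `D` — the multiset relational semantics of the
derivation read as a soft-linear-logic proof (exponential `!σ` = finite multisets of points, `(σ ⊸ A)° = σ°⊥ ⅋ A°`,
`∀` read untypedly), i.e. the results of the experiments (LTdF Def. 12) of the net of the derivation.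

* `STA.Deriv d Γ M σ` — typing derivations as DATA (a `Type`-valued copy of the `Prop`-valued judgement
  `STA.Typing`, same ten rules, same indices; `STA.Deriv.typing`, `STA.Typing.nonempty_deriv`): the
  interpretation depends on the derivation, not only on the judgement, and `Prop` cannot be recursed on.
* `STA.Deriv.interp Π ⊆ URel.Val × URel.Point` — the relational interpretation: a VALUATION
  `ρ : URel.Val = ℕ → Option URel.Point` labels every hypothesis wire of the context (slot `i ↦ some v`, absent
  slots `none`), the point is the label of the conclusion; one clause per rule (list below).
  `STA.Deriv.rank Π` — the rank `rk(Π)`, the maximal size of a multiplexor `(m)` in `Π` (GMR08 §3.1).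
* `SoftProgramInterpretation Π ⊆ URel.Point` — for a CLOSED derivation (context `STA.Ctx.empty`, e.g. a program
  `⊢ M : !ⁿ S_m ⊸ B` or a datum) the set of results: THE notion requested.
* SOFTNESS, proved (`STA.Deriv.act_mem_interp`, `obsessionalFrom_softProgramInterpretation`): `⟦Π⟧` is
  `t`-obsessional for every `t ≥ max 1 rk(Π)` — the interpretation of a soft derivation is obsessional FROM ITS
  MULTIPLEXING RANK (LTdF §2.2: multiplexing of rank `n` is obsessional for `t ≥ n`, functorial promotion for every
  `t`, dereliction for `t ≥ 1`; Prop. 8). CALIBRATION REMARK for the route PneNP/LightLogic: the threshold is the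
  rank, NOT the level `max d(Π) n` of `SoftRepresentsAtLevel` (the level does not bound the rank, and a rank-`r`
  multiplexing clique `{(![x₁,…,x_r], (x₁,…,x_r))}` of LTdF §2.2 is `t`-obsessional only for `t ≥ r`); the
  threshold `1` is sharp already for `⟦λx.x⟧ = URel.derelictionClique` (`softProgramInterpretation_idD`,
  `URel.not_obsessionalFrom_zero_derelictionClique`).
* The STA-native word→boolean INTERFACE: `URel.zeroClique = ⟦⊢ 0 : B⟧`, `URel.oneClique = ⟦⊢ 1 : B⟧` (computed:
  `softProgramInterpretation_zeroD/oneD`; disjoint and nonempty, `zeroClique_ne_oneClique`), the semantic promotion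
  `URel.bangClique`, the argument clique `URel.argClique n A` of an `n`-fold promoted closed argument, semantic
  application `URel.progApply n c A` (the cut clause of LTdF Def. 12 at the type `!ⁿ S ⊸ B`), and
  `URel.STADecides n m c L` (for every word `w` and every derivation of `⊢ w̲ : S_m`, applying `c` to the promoted
  word gives exactly `⟦0⟧` if `w ∈ L` and exactly `⟦1⟧` if `w ∉ L`).

## The clauses (LTdF Def. 12 read on STA rules; GMR08 Table 2 / §2 for the SLL meaning of the rules)

Points of `D`: `x ::= 1 | ⊥ | x ⊗ x | x ⅋ x | !μ | ?μ`; `x̄` the dual. Write `![a]` for `URel.bang1 a`, `![]` for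
`URel.bang0`.
* `(Ax)  x : A ⊢ x : A` — valuation `x ↦ ![a]`, result `a`, for every `a ∈ D` (axiom link, any label: untyped).
* `(w)   Γ, x : A ⊢ M : σ` from `Γ ⊢ M : σ` — `x ↦ ![]` (a discarded hypothesis: `?w`, label `?[]`).
* `(⊸I)  Γ ⊢ λx.M : σ ⊸ A` — result `V̄ ⅋ p` where `V` is the label of `x` and `p` the result of the premise
  (`⅋`-node; `(σ ⊸ A)° = σ°⊥ ⅋ A°`).
* `(⊸E)  Γ, Δ ⊢ M N : A` — a result `V̄ ⅋ p` of `M` CUT against a run of the argument with label `V`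
  (cut clause: dual labels); valuations of `Γ` and `Δ` juxtaposed. For a MODAL argument `N : !ᵏB`, `k ≥ 1`, the
  run is a run of `N` (whose results are `!`-points, by `(sp)`); for a LINEAR argument (`k = 0`) the run is a run
  of the `≤ 1`-box of `N`: either `(ρ, ![b])` for a run `(ρ, b)` of `N`, or the discarding run `(Δ ↦ ![], ![])`
  (`URel.liftArg`).
* `(m)   Γ, x : !σ ⊢ M[x/xᵢ] : μ` from `Γ, x₁ : σ, …, x_n : σ ⊢ M : μ` — `x ↦ ![v₁, …, v_n]`, the multiset of the
  labels of the `n` contracted wires (`?d` on each, then the `?c`-tree: label `?[v̄₁,…,v̄_n]` on the dual side).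
* `(sp)  !Γ ⊢ M : !σ` from `Γ ⊢ M : σ` — a finite multiset `R` of runs of the premise (of its `≤ 1`-box if `σ` is
  linear): result `![p_r | r ∈ R]`, every hypothesis `y ↦ ![label of y in r | r ∈ R]` (box clause of Def. 12:
  main door and auxiliary doors collect the `card R` copies).
* `(∀I), (∀E)` — identity (nets are untyped: quantifier nodes are erased, LTdF Remark 1).
* `(sum) Γ ⊢ M + N : A` — union (non-deterministic choice is interpreted by union of interpretations in relational
  models, Bucciarelli–Ehrhard–Manzonetto 2012).

## Conventions of this file (NOT printed in LTdF or GMR08) and their reason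

`STA` is an AFFINE system — rule `(w)` discards a LINEAR hypothesis ("projectors are definable as usual because
STA is an affine system", GMR08 §3.2; its booleans `0 = λxy.x`, `1 = λxy.y` are affine) — while LTdF's nets are
LINEAR (weakening only on `?`-edges) and the relational model has no natural interpretation of affine weakening
(`1 ≇ ⊤` in `REL`). We read `STA` through the standard embedding of affine logic into linear logic with the
additive unit, `A ↦ A & 1` on linear hypotheses: a linear hypothesis is used (`π₁`) or discarded (`π₂`), and a
linear ARGUMENT is the pair ⟨the argument, discard everything⟩. The web `|A| ⊎ {∗}` of `A & 1` is coded
injectively in `D` by `a ↦ ![a]`, `∗ ↦ ![]` — i.e. a linear hypothesis is a `!`-hypothesis used AT MOST ONCE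
(`?d` or `?w`: a multiplexor of rank `≤ 1`, which IS soft linear logic), and a linear argument is a box taken with at
most one copy. Consequences, all deliberate: (i) `⟦λx.x⟧` is the DERELICTION clique `{?[x̄] ⅋ x}`
(`URel.derelictionClique`), not the axiom clique, and no interpretation is `0`-obsessional (dereliction is not,
LTdF §2.2) — hence the threshold `max 1 rk(Π)`; (ii) `⟦0⟧ = {?[ā] ⅋ (?[] ⅋ a)}`, `⟦1⟧ = {?[] ⅋ (?[ā] ⅋ a)}` are
the relational (System R, de Carvalho) points `([a],[],a)` / `([],[a],a)` of `λxy.x` / `λxy.y`; (iii) a discarded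
copy under a multiplexor or a promotion contributes an ELEMENT `![]` to the multiset (no flattening), so that every
copy / run of a box contributes exactly one element to every door — this lockstep of cardinalities is what
obsessionality expresses, and flattening the `≤ 1`-layer would break it under affine erasure (a promoted `f z`
with `f`, `z` linear would not be obsessional from any `t`). Reading instead EVERY argument as a box with
arbitrarily many copies (Girard's translation, de Carvalho's System R) interprets the bare λ-term but produces
non-soft nets (`λfgz.f (g z)` gets an exponential branch `?d ?p ?p`), whose interpretations are not obsessional:
the boxes must be exactly STA's `(sp)` rules. Absent context slots are `none`; `URel.Val.merge` juxtaposes the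
two disjoint valuations of `(⊸E)`.

## What is NOT here (and is not claimed)

* INVARIANCE `⟦Π⟧ = ⟦Π'⟧` along `STA.Red` (for the subject-reduction image `Π'` of `Π`; LTdF Thm 3 is the
  statement for cut elimination of NETS) and ADEQUACY (`STA.DecidesByZero M L` with `Π ▹ ⊢ M : !ⁿ S_m ⊸ B`
  implies `URel.STADecides n m ⟦Π⟧ L`) are NOT proved here and NOT vendored as named facts: for this reading of
  STA derivations they are not printed theorems (the expected proof is the semantic substitution lemma for the
  clauses above, through GMR08's substitution lemma). They are the natural next items; everything below is either
  a definition or proved.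
* No translation into LTdF's graph-theoretic nets (Def. 5–11), no `cosize`, no Thm 4.
* No coercion to the Lafont-style data of `CliqueDecides.lean` (`URel.wordClique`, `URel.boolClique`: the
  MULTIPLICATIVE booleans `(α ⊗ α) ⊸ (α ⊗ α)` and words `W`, bracketed there): `STA` has no `⊗`, its data are the
  affine booleans and `S_m`, and the two boolean cliques of `CliqueDecides` overlap (`REL` is not complete), so no
  canonical coercion clique exists; `URel.STADecides` is the STA-native analogue of `URel.CliqueDecides` (same
  shape: total and consistent at the interface, decided language unique).

## References

* [LaurentTortoraDeFalco2006] O. Laurent, L. Tortora de Falco, *Obsessional cliques: a semantic characterization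
  of bounded time complexity*, LICS 2006, doi:10.1109/lics.2006.37 — §2.2 (obsessionality of the exponential
  structure), Def. 12 (experiments), Remark 1–2, Def. 13, Prop. 8, §6.
* [GaboardiMarionRonchidellarocca2008] M. Gaboardi, J.-Y. Marion, S. Ronchi Della Rocca, *Soft Linear Logic and
  Polynomial Complexity Classes*, ENTCS 205 (2008), doi:10.1016/j.entcs.2008.03.066 — §2 (SLL: multiplexor of rank
  `n`, soft promotion), Table 2, §3.1 (rank `rk(Π)`), §3.2 (affine).
* [BucciarelliEhrhardManzonetto2012] A. Bucciarelli, T. Ehrhard, G. Manzonetto, *A relational semantics for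
  parallelism and non-determinism in a functional setting*, APAL 163 (2012), doi:10.1016/j.apal.2011.09.008
  (non-deterministic choice = union of interpretations).
* [Carvalho2009] D. de Carvalho, *Execution time of λ-terms via denotational semantics and intersection types*,
  arXiv:0905.4251 / MSCS 28 (2018) (System R: the relational semantics of λ-terms, `[a₁,…,a_n] → a`).
-/

namespace Literature.Computability.ImplicitComplexity

open URel

/-! ### Typing derivations as data -/

namespace STA

/-- Typing derivations of `STA₊` as DATA: `Deriv d Γ M σ` is the type of derivations `Π ▹ Γ ⊢ M : σ` of degree
`d`, with exactly the rules (and side conditions) of the judgement `STA.Typing` — `(Ax) (w) (⊸I) (⊸E) (m) (sp)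
(∀I) (∀E)` of GMR08 Table 2 and `(sum)` of Table 5 (see `STA.Typing` for the rules as printed). A `Type`-valued
copy is needed because the interpretation is a function of the derivation.
[cite: GaboardiMarionRonchidellarocca2008, Table 2, Table 5, Def. A.1] -/
inductive Deriv : ℕ → Ctx → Term → SoftTy → Type
  | ax {Γ : Ctx} {i : ℕ} {A : LinTy} (h : Γ.IsSingleton i ⟨0, A⟩) : Deriv 0 Γ (.var i) ⟨0, A⟩
  | weak {d : ℕ} {Γ Γ' : Ctx} {M : Term} {τ : SoftTy} (j : ℕ) (A : LinTy)
      (h : Deriv d Γ M τ) (hj : Γ j = none) (hΓ' : Γ' = Function.update Γ j (some ⟨0, A⟩)) :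
      Deriv d Γ' M τ
  | lam {d : ℕ} {Γ : Ctx} {M : Term} {k : ℕ} {B A : LinTy}
      (h : Deriv d (Ctx.cons (some ⟨k, B⟩) Γ) M ⟨0, A⟩) :
      Deriv d Γ (.lam M) ⟨0, .limp k B A⟩
  | app {d₁ d₂ : ℕ} {Γ Γ₁ Γ₂ : Ctx} {M N : Term} {k : ℕ} {B A : LinTy}
      (hs : Γ.Split Γ₁ Γ₂) (h₁ : Deriv d₁ Γ₁ M ⟨0, .limp k B A⟩) (h₂ : Deriv d₂ Γ₂ N ⟨k, B⟩) :
      Deriv (max d₁ d₂) Γ (.app M N) ⟨0, A⟩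
  | mpx {d : ℕ} {Γ Γ' : Ctx} {M M' : Term} {μ σ : SoftTy} (S : Finset ℕ) (j : ℕ)
      (h : Deriv d Γ M μ) (hS : ∀ i ∈ S, Γ i = some σ) (hj : Γ j = none)
      (hΓ' : Γ' = Γ.mpx S j σ) (hM' : M' = M.rename (mpxRen S j)) :
      Deriv d Γ' M' μ
  | sp {d : ℕ} {Γ Γ' : Ctx} {M : Term} {k : ℕ} {A : LinTy}
      (h : Deriv d Γ M ⟨k, A⟩) (hΓ' : Γ' = Γ.bang) :
      Deriv (d + 1) Γ' M ⟨k + 1, A⟩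
  | allI {d : ℕ} {Γ Δ : Ctx} {M : Term} {A : LinTy}
      (h : Deriv d Δ M ⟨0, A⟩) (hΔ : Δ = Γ.shift) :
      Deriv d Γ M ⟨0, .all A⟩
  | allE {d : ℕ} {Γ : Ctx} {M : Term} {B : LinTy} (A : LinTy)
      (h : Deriv d Γ M ⟨0, .all B⟩) :
      Deriv d Γ M ⟨0, B.inst A⟩
  | sum {d₁ d₂ : ℕ} {Γ : Ctx} {M N : Term} {A : LinTy}
      (h₁ : Deriv d₁ Γ M ⟨0, A⟩) (h₂ : Deriv d₂ Γ N ⟨0, A⟩) :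
      Deriv (max d₁ d₂) Γ (.sum M N) ⟨0, A⟩

namespace Deriv

/-- A derivation derives its judgement. [cite: GaboardiMarionRonchidellarocca2008, Table 2] -/
theorem typing : {d : ℕ} → {Γ : Ctx} → {M : Term} → {σ : SoftTy} → Deriv d Γ M σ → Typing d Γ M σ
  | _, _, _, _, .ax h => Typing.ax h
  | _, _, _, _, .weak j A h hj hΓ' => Typing.weak j A h.typing hj hΓ'
  | _, _, _, _, .lam h => Typing.lam h.typing
  | _, _, _, _, .app hs h₁ h₂ => Typing.app hs h₁.typing h₂.typing
  | _, _, _, _, .mpx S j h hS hj hΓ' hM' => Typing.mpx S j h.typing hS hj hΓ' hM'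
  | _, _, _, _, .sp h hΓ' => Typing.sp h.typing hΓ'
  | _, _, _, _, .allI h hΔ => Typing.allI h.typing hΔ
  | _, _, _, _, .allE A h => Typing.allE A h.typing
  | _, _, _, _, .sum h₁ h₂ => Typing.sum h₁.typing h₂.typing

/-- The rank `rk(Π)`: the maximal number of contracted slots of a multiplexor `(m)` in `Π` (`0` if none). GMR08
count only the contracted variables that occur; this syntactic count is an upper bound, which is all the
obsessionality threshold needs. [cite: GaboardiMarionRonchidellarocca2008, §3.1] -/
def rank : {d : ℕ} → {Γ : Ctx} → {M : Term} → {σ : SoftTy} → Deriv d Γ M σ → ℕ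
  | _, _, _, _, .ax _ => 0
  | _, _, _, _, .weak _ _ h _ _ => h.rank
  | _, _, _, _, .lam h => h.rank
  | _, _, _, _, .app _ h₁ h₂ => max h₁.rank h₂.rank
  | _, _, _, _, .mpx S _ h _ _ _ _ => max S.card h.rank
  | _, _, _, _, .sp h _ => h.rank
  | _, _, _, _, .allI h _ => h.rank
  | _, _, _, _, .allE _ h => h.rank
  | _, _, _, _, .sum h₁ h₂ => max h₁.rank h₂.rank

end Deriv

/-- Every derivable judgement has a derivation (the `Prop`-judgement `STA.Typing` and the data `STA.Deriv` have the
same rules). [cite: GaboardiMarionRonchidellarocca2008, Table 2] -/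
theorem Typing.nonempty_deriv {d : ℕ} {Γ : Ctx} {M : Term} {σ : SoftTy} (h : Typing d Γ M σ) :
    Nonempty (Deriv d Γ M σ) := by
  induction h with
  | ax h => exact ⟨.ax h⟩
  | weak j A _ hj hΓ' ih => exact ih.elim fun D => ⟨.weak j A D hj hΓ'⟩
  | lam _ ih => exact ih.elim fun D => ⟨.lam D⟩
  | app hs _ _ ih₁ ih₂ => exact ih₁.elim fun D₁ => ih₂.elim fun D₂ => ⟨.app hs D₁ D₂⟩
  | mpx S j _ hS hj hΓ' hM' ih => exact ih.elim fun D => ⟨.mpx S j D hS hj hΓ' hM'⟩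
  | sp _ hΓ' ih => exact ih.elim fun D => ⟨.sp D hΓ'⟩
  | allI _ hΔ ih => exact ih.elim fun D => ⟨.allI D hΔ⟩
  | allE A _ ih => exact ih.elim fun D => ⟨.allE A D⟩
  | sum _ _ ih₁ ih₂ => exact ih₁.elim fun D₁ => ih₂.elim fun D₂ => ⟨.sum D₁ D₂⟩

/-- Derivability is exactly the existence of a derivation. [cite: GaboardiMarionRonchidellarocca2008, Table 2] -/
theorem typing_iff_nonempty_deriv {d : ℕ} {Γ : Ctx} {M : Term} {σ : SoftTy} :
    Typing d Γ M σ ↔ Nonempty (Deriv d Γ M σ) :=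
  ⟨Typing.nonempty_deriv, fun ⟨D⟩ => D.typing⟩

end STA

/-! ### Valuations and the point-level vocabulary of the clauses -/

namespace URel

/-- Valuations: the label (a point of `D`) of every hypothesis wire of a context, `none` on absent slots.
[cite: LaurentTortoraDeFalco2006, Def. 12] -/
abbrev Val : Type := ℕ → Option Point

/-- `![]` — the empty box: the label of a discarded linear hypothesis (`?w`: `?[]` on the dual side), of a rank-`0`
multiplexor, of a promotion with no copy. [cite: LaurentTortoraDeFalco2006, Def. 12] -/
noncomputable def bang0 : Point := Point.ofCourse 0

/-- `![a]` — the one-copy box: the label of a linear hypothesis used with label `a` (`?d`: `?[ā]` on the dual side).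
[cite: LaurentTortoraDeFalco2006, Def. 12] -/
noncomputable def bang1 (a : Point) : Point := Point.ofCourse {a}

namespace Val

/-- The valuation of the singleton context `x_i : A` with label `v`. [cite: LaurentTortoraDeFalco2006, Def. 12] -/
def single (i : ℕ) (v : Point) : Val := fun j => if j = i then some v else none

/-- Juxtaposition of the valuations of two disjoint contexts (`Γ # Δ` in `(⊸E)`). [folklore] -/
def merge (ρ₁ ρ₂ : Val) : Val := fun i =>
  match ρ₁ i with
  | some v => some v
  | none => ρ₂ i

/-- Leaving a binder: slot `i + 1` of the premise is slot `i` of the conclusion of `(⊸I)`. [folklore] -/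
def unshift (ρ : Val) : Val := fun i => ρ (i + 1)

/-- The valuation discarding every hypothesis of `Γ`: each present slot is labelled `![]`.
[cite: LaurentTortoraDeFalco2006, Def. 12] -/
noncomputable def discard (Γ : STA.Ctx) : Val := fun i => if Γ i = none then none else some bang0

/-- The label of slot `i` (junk value `1` on an absent slot; only read on present slots). [folklore] -/
def label (ρ : Val) (i : ℕ) : Point := (ρ i).getD Point.one

/-- The `t`-action of `ℕ*` on valuations: slotwise (LTdF Def. 13 on every label).
[cite: LaurentTortoraDeFalco2006, Def. 13] -/
def act (t k : ℕ) (ρ : Val) : Val := fun i => (ρ i).map (Point.act t k)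

end Val

/-- A run `(valuation, result)` acted upon by `k` at threshold `t`. [cite: LaurentTortoraDeFalco2006, Def. 13] -/
def actRun (t k : ℕ) (r : Val × Point) : Val × Point := (r.1.act t k, r.2.act t k)

/-- The runs of the `≤ 1`-box of a set `S` of runs over the context `Γ` (the argument of a LINEAR application, the
premise of a promotion of a LINEAR type): one copy `(ρ, ![b])` of a run `(ρ, b)`, or no copy `(discard Γ, ![])`.
This is the pair ⟨argument, discard⟩ of the affine-to-linear translation `A ↦ A & 1`, its web `|A| ⊎ {∗}` coded by
`![a]` / `![]` (convention of this file). For a MODAL type (`k ≥ 1` bangs) nothing is changed.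
[cite: LaurentTortoraDeFalco2006, Def. 12 (box clause)] -/
def liftArg : ℕ → STA.Ctx → Set (Val × Point) → Set (Val × Point)
  | 0, Γ, S => {r | (∃ ρ b, (ρ, b) ∈ S ∧ r = (ρ, bang1 b)) ∨ r = (Val.discard Γ, bang0)}
  | _ + 1, _, S => S

/-- The valuation of the conclusion of a multiplexor `(m)` contracting the slots `S` into the fresh slot `j`:
`x ↦ ![v_i | i ∈ S]`. [cite: LaurentTortoraDeFalco2006, Def. 12 (`?d`, `?c`, `?w` clauses)] -/
noncomputable def mpxVal (S : Finset ℕ) (j : ℕ) (ρ : Val) : Val := fun i =>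
  if i ∈ S then none else if i = j then some (Point.ofCourse (S.val.map ρ.label)) else ρ i

/-- The valuation of the conclusion `!Γ` of a promotion `(sp)` built from the multiset `R` of runs of the premise:
every present slot `y ↦ ![label of y in r | r ∈ R]` (auxiliary doors of the box).
[cite: LaurentTortoraDeFalco2006, Def. 12 (box clause)] -/
noncomputable def spVal (Γ : STA.Ctx) (R : Multiset (Val × Point)) : Val := fun i =>
  if Γ i = none then none else some (Point.ofCourse (R.map fun r => r.1.label i))

end URel

/-! ### The interpretation -/

namespace STA.Deriv

/-- **The relational interpretation of an `STA₊` derivation** `Π ▹ Γ ⊢ M : σ`: the set of runs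
`(ρ, p) ∈ URel.Val × URel.Point` — `ρ` labels the hypotheses, `p` the conclusion — defined by recursion on `Π`
with one clause per rule (module docstring): axiom = any label `a`, hypothesis `![a]`; `(w)` = label `![]`;
`(⊸I)` = `V̄ ⅋ p`; `(⊸E)` = cut of a result `V̄ ⅋ p` of the function against a run of (the `≤1`-box of, if linear)
the argument with label `V`; `(m)` = `![labels of the contracted wires]`; `(sp)` = a finite multiset of runs, doors
collecting the copies; `(∀I)/(∀E)` = identity; `(sum)` = union. These are the clauses of LTdF's experiments
(Def. 12) on the soft-linear-logic reading of the rules (GMR08 §2), with the affine conventions of this file.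
[cite: LaurentTortoraDeFalco2006, Def. 12] -/
def interp : {d : ℕ} → {Γ : Ctx} → {M : Term} → {σ : SoftTy} → Deriv d Γ M σ → Set (URel.Val × URel.Point)
  | _, _, _, _, .ax (i := i) _ => {r | ∃ a : URel.Point, r = (URel.Val.single i (URel.bang1 a), a)}
  | _, _, _, _, .weak j _ h _ _ =>
      {r | ∃ ρ p, (ρ, p) ∈ h.interp ∧ r = (Function.update ρ j (some URel.bang0), p)}
  | _, _, _, _, .lam h =>
      {r | ∃ ρ p V, (ρ, p) ∈ h.interp ∧ ρ 0 = some V ∧ r = (URel.Val.unshift ρ, (V.dual).par p)}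
  | _, _, _, _, .app (Γ₂ := Γ₂) (k := k) _ h₁ h₂ =>
      {r | ∃ ρ₁ ρ₂ V p, (ρ₁, (V.dual).par p) ∈ h₁.interp ∧ (ρ₂, V) ∈ URel.liftArg k Γ₂ h₂.interp ∧
        r = (URel.Val.merge ρ₁ ρ₂, p)}
  | _, _, _, _, .mpx S j h _ _ _ _ => {r | ∃ ρ p, (ρ, p) ∈ h.interp ∧ r = (URel.mpxVal S j ρ, p)}
  | _, _, _, _, .sp (Γ := Γ) (k := k) h _ =>
      {r | ∃ R : Multiset (URel.Val × URel.Point), (∀ x ∈ R, x ∈ URel.liftArg k Γ h.interp) ∧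
        r = (URel.spVal Γ R, URel.Point.ofCourse (R.map Prod.snd))}
  | _, _, _, _, .allI h _ => h.interp
  | _, _, _, _, .allE _ h => h.interp
  | _, _, _, _, .sum h₁ h₂ => h₁.interp ∪ h₂.interp

/-- The RESULTS of a derivation: the labels of the conclusion over all runs (for a closed derivation the valuation
is empty and this is the whole interpretation). [cite: LaurentTortoraDeFalco2006, Def. 12] -/
def results {d : ℕ} {Γ : Ctx} {M : Term} {σ : SoftTy} (D : Deriv d Γ M σ) : Set URel.Point :=
  {p | ∃ ρ, (ρ, p) ∈ D.interp}

end STA.Deriv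

/-- **The relational interpretation `⟦Π⟧ ⊆ D` of a closed soft program** (or datum): the set of results of the
experiments of a derivation `Π ▹ ⊢ M : σ` of `STA₊` in the empty context — for a program `⊢ M : !ⁿ S_m ⊸ B` a clique
of points `V̄ ⅋ b` (`V = !ⁿ`-box of word points, `b` a boolean point). The interpretation of a derivable closed
JUDGEMENT is obtained from `STA.Typing.nonempty_deriv`. [cite: LaurentTortoraDeFalco2006, Def. 12] -/
def SoftProgramInterpretation {d : ℕ} {M : STA.Term} {σ : STA.SoftTy}
    (D : STA.Deriv d STA.Ctx.empty M σ) : Set URel.Point :=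
  D.results


/-! ### The action on boxes, valuations and runs -/

namespace URel

/-- The exponential clause of the `t`-action (LTdF Def. 13) on a multiset of POINTS already acted upon: unchanged
if it has at most `t` elements, every multiplicity multiplied by `k` otherwise (`PrePoint.bump` read in `D`).
[cite: LaurentTortoraDeFalco2006, Def. 13] -/
def mbump (t k : ℕ) (m : Multiset Point) : Multiset Point := if Multiset.card m ≤ t then m else k • m

/-- Small boxes are unchanged. [cite: LaurentTortoraDeFalco2006, Def. 13] -/
theorem mbump_of_card_le {t k : ℕ} {m : Multiset Point} (h : Multiset.card m ≤ t) : mbump t k m = m :=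
  if_pos h

/-- Large boxes have their multiplicities multiplied. [cite: LaurentTortoraDeFalco2006, Def. 13] -/
theorem mbump_of_lt {t k : ℕ} {m : Multiset Point} (h : t < Multiset.card m) : mbump t k m = k • m :=
  if_neg (Nat.not_le.2 h)

/-- **The action on a box of points**: `(!μ)ₜ⁽ᵏ⁾ = !(mbump t k (μ pointwise acted upon))` — Def. 13 on `D`, for a
multiset of points rather than a list of pre-points. [cite: LaurentTortoraDeFalco2006, Def. 13] -/
theorem Point.act_ofCourse (t k : ℕ) (m : Multiset Point) :
    Point.act t k (Point.ofCourse m) = Point.ofCourse (mbump t k (m.map (Point.act t k))) := by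
  have hm := Point.coe_map_mk_toList_out m
  have h1 : Point.ofCourse m = Point.mk (PrePoint.ofCourse ((m.map Quotient.out).toList)) := rfl
  rw [h1]
  generalize (m.map Quotient.out).toList = l at hm ⊢
  subst hm
  rw [Point.act_mk]
  simp only [PrePoint.act]
  rw [PrePoint.actList_eq_map, Point.mk_ofCourse, PrePoint.map_bump]
  congr 1
  have hcomp : (Point.act t k ∘ Point.mk) = (Point.mk ∘ PrePoint.act t k) := funext fun _ => rfl
  rw [PrePoint.coe_bump, List.map_map, mbump, Multiset.map_coe, List.map_map, hcomp]
  simp only [Multiset.coe_card, List.length_map]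

/-- `(![])ₜ⁽ᵏ⁾ = ![]`. [cite: LaurentTortoraDeFalco2006, Def. 13] -/
@[simp] theorem act_bang0 (t k : ℕ) : Point.act t k bang0 = bang0 := by
  unfold bang0
  rw [Point.act_ofCourse, Multiset.map_zero, mbump_of_card_le (by simp)]

/-- `(![a])ₜ⁽ᵏ⁾ = ![(a)ₜ⁽ᵏ⁾]` for `t ≥ 1` (a one-element box is small). [cite: LaurentTortoraDeFalco2006, Def. 13] -/
theorem act_bang1 {t : ℕ} (ht : 1 ≤ t) (k : ℕ) (a : Point) :
    Point.act t k (bang1 a) = bang1 (a.act t k) := by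
  unfold bang1
  rw [Point.act_ofCourse, Multiset.map_singleton, mbump_of_card_le (by simpa using ht)]

namespace Val

variable (t k : ℕ)

/-- The action on a valuation, slotwise. [cite: LaurentTortoraDeFalco2006, Def. 13] -/
@[simp] theorem act_apply (ρ : Val) (i : ℕ) : act t k ρ i = (ρ i).map (Point.act t k) := rfl

/-- The action on a singleton valuation. [cite: LaurentTortoraDeFalco2006, Def. 13] -/
theorem act_single (i : ℕ) (v : Point) : act t k (single i v) = single i (v.act t k) := by
  funext j
  simp only [act, single]
  split_ifs <;> rfl

/-- The action commutes with juxtaposition. [cite: LaurentTortoraDeFalco2006, Def. 13] -/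
theorem act_merge (ρ₁ ρ₂ : Val) : act t k (merge ρ₁ ρ₂) = merge (act t k ρ₁) (act t k ρ₂) := by
  funext i
  simp only [act, merge]
  cases ρ₁ i <;> rfl

/-- The action commutes with leaving a binder. [cite: LaurentTortoraDeFalco2006, Def. 13] -/
theorem act_unshift (ρ : Val) : act t k (unshift ρ) = unshift (act t k ρ) := rfl

/-- The action commutes with setting one slot. [cite: LaurentTortoraDeFalco2006, Def. 13] -/
theorem act_update (ρ : Val) (j : ℕ) (v : Point) :
    act t k (Function.update ρ j (some v)) = Function.update (act t k ρ) j (some (v.act t k)) := by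
  funext i
  by_cases h : i = j
  · subst h
    simp [act]
  · simp [act, Function.update_of_ne h]

/-- The discarding valuation is fixed by the action. [cite: LaurentTortoraDeFalco2006, Def. 13] -/
@[simp] theorem act_discard (Γ : STA.Ctx) : act t k (discard Γ) = discard Γ := by
  funext i
  simp only [act, discard]
  split_ifs <;> simp

/-- The action on the label of a slot. [cite: LaurentTortoraDeFalco2006, Def. 13] -/
theorem label_act (ρ : Val) (i : ℕ) : (act t k ρ).label i = (ρ.label i).act t k := by
  simp only [label, act]
  cases ρ i <;> simp

end Val

/-- The action on a run, first component. [cite: LaurentTortoraDeFalco2006, Def. 13] -/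
@[simp] theorem actRun_fst (t k : ℕ) (r : Val × Point) : (actRun t k r).1 = r.1.act t k := rfl

/-- The action on a run, second component. [cite: LaurentTortoraDeFalco2006, Def. 13] -/
@[simp] theorem actRun_snd (t k : ℕ) (r : Val × Point) : (actRun t k r).2 = r.2.act t k := rfl

/-- **Multiplexing of rank `≤ t` is `t`-obsessional** (LTdF §2.2: `{([a₁,…,a_n], (a₁,…,a_n))}` is obsessional for
`t ≥ n`): the action commutes with the `(m)`-valuation when `|S| ≤ t`. [cite: LaurentTortoraDeFalco2006, §2.2] -/
theorem act_mpxVal {t : ℕ} (k : ℕ) {S : Finset ℕ} (hS : S.card ≤ t) (j : ℕ) (ρ : Val) :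
    Val.act t k (mpxVal S j ρ) = mpxVal S j (Val.act t k ρ) := by
  funext i
  simp only [Val.act, mpxVal]
  split_ifs with h1 h2
  · rfl
  · rw [Option.map_some, Point.act_ofCourse, Multiset.map_map,
      mbump_of_card_le (by rwa [Multiset.card_map, Finset.card_val])]
    congr 2
    refine Multiset.map_congr rfl fun x _ => ?_
    simp [Val.label_act]
  · rfl

/-- **Functorial promotion is obsessional for every `t`** (LTdF §2.2, first bullet), small box: with at most `t`
runs every door is acted upon pointwise. [cite: LaurentTortoraDeFalco2006, §2.2] -/
theorem act_spVal_of_le {t : ℕ} (k : ℕ) (Γ : STA.Ctx) {R : Multiset (Val × Point)}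
    (h : Multiset.card R ≤ t) : Val.act t k (spVal Γ R) = spVal Γ (R.map (actRun t k)) := by
  funext i
  simp only [Val.act, spVal]
  split_ifs with hi
  · rfl
  · rw [Option.map_some, Point.act_ofCourse, Multiset.map_map, Multiset.map_map,
      mbump_of_card_le (by rwa [Multiset.card_map])]
    congr 2
    refine Multiset.map_congr rfl fun x _ => ?_
    simp [Val.label_act]

/-- **Functorial promotion is obsessional for every `t`**, large box: with more than `t` runs every door has more
than `t` elements and all are multiplied by `k` — realised by `k` times as many runs.
[cite: LaurentTortoraDeFalco2006, §2.2] -/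
theorem act_spVal_of_lt {t : ℕ} (k : ℕ) (Γ : STA.Ctx) {R : Multiset (Val × Point)}
    (h : t < Multiset.card R) : Val.act t k (spVal Γ R) = spVal Γ (k • R.map (actRun t k)) := by
  funext i
  simp only [Val.act, spVal]
  split_ifs with hi
  · rfl
  · rw [Option.map_some, Point.act_ofCourse, Multiset.map_map, Multiset.map_nsmul, Multiset.map_map,
      mbump_of_lt (by rwa [Multiset.card_map])]
    congr 3
    refine Multiset.map_congr rfl fun x _ => ?_
    simp [Val.label_act]

/-- The `≤ 1`-box of a `t`-obsessional set of runs is `t`-obsessional for `t ≥ 1` (one-element and empty boxes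
are small). [cite: LaurentTortoraDeFalco2006, §2.2] -/
theorem actRun_mem_liftArg {t k : ℕ} (ht : 1 ≤ t) {S : Set (Val × Point)}
    (hS : ∀ r ∈ S, actRun t k r ∈ S) :
    ∀ (n : ℕ) (Γ : STA.Ctx), ∀ r ∈ liftArg n Γ S, actRun t k r ∈ liftArg n Γ S
  | 0, Γ, r, hr => by
      rcases hr with ⟨ρ, b, hb, rfl⟩ | rfl
      · exact Or.inl ⟨_, _, hS _ hb, by simp [actRun, act_bang1 ht]⟩
      · exact Or.inr (by simp [actRun])
  | _ + 1, _, r, hr => hS r hr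

end URel

/-! ### Softness: the interpretation is obsessional from the multiplexing rank -/

namespace STA.Deriv

/-- **The interpretation of a soft derivation is `t`-obsessional for every `t ≥ max 1 rk(Π)`**, run by run: if
`(ρ, p) ∈ ⟦Π⟧` and `k ≥ 1` then `((ρ)ₜ⁽ᵏ⁾, (p)ₜ⁽ᵏ⁾) ∈ ⟦Π⟧`. Rule by rule this is LTdF §2.2: axiom, `⅋`, cut and
juxtaposition are homomorphic; a multiplexor of rank `n ≤ t` is acted upon pointwise; a promotion with `j` runs
is acted upon pointwise if `j ≤ t` and realised by `k·j` runs if `j > t` (main door and auxiliary doors have the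
same number `j` of elements); the `≤ 1`-boxes of the affine reading need `t ≥ 1` (dereliction).
[cite: LaurentTortoraDeFalco2006, §2.2 and Prop. 8] -/
theorem act_mem_interp {t k : ℕ} (hk : 0 < k) (ht₁ : 1 ≤ t) :
    {d : ℕ} → {Γ : Ctx} → {M : Term} → {σ : SoftTy} → (D : Deriv d Γ M σ) → D.rank ≤ t →
      ∀ {r : URel.Val × URel.Point}, r ∈ D.interp → URel.actRun t k r ∈ D.interp
  | _, _, _, _, .ax _, _, r, hr => by
      obtain ⟨a, rfl⟩ := hr
      exact ⟨a.act t k, by simp [URel.actRun, URel.Val.act_single, URel.act_bang1 ht₁]⟩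
  | _, _, _, _, .weak j A h hj hΓ', hrk, r, hr => by
      obtain ⟨ρ, p, hm, rfl⟩ := hr
      exact ⟨_, _, act_mem_interp hk ht₁ h hrk hm, by simp [URel.actRun, URel.Val.act_update]⟩
  | _, _, _, _, .lam h, hrk, r, hr => by
      obtain ⟨ρ, p, V, hm, h0, rfl⟩ := hr
      refine ⟨_, _, V.act t k, act_mem_interp hk ht₁ h hrk hm, by simp [h0], ?_⟩
      simp [URel.actRun, URel.Val.act_unshift, URel.Point.dual_act]
  | _, _, _, _, .app (k := k') (Γ₂ := Γ₂) hs h₁ h₂, hrk, r, hr => by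
      obtain ⟨ρ₁, ρ₂, V, p, hm₁, hm₂, rfl⟩ := hr
      have hr₁ : h₁.rank ≤ t := le_trans (le_max_left _ _) hrk
      have hr₂ : h₂.rank ≤ t := le_trans (le_max_right _ _) hrk
      have ih₁ := act_mem_interp hk ht₁ h₁ hr₁ hm₁
      have ih₂ := URel.actRun_mem_liftArg ht₁ (fun r hr => act_mem_interp hk ht₁ h₂ hr₂ hr) k' Γ₂ _ hm₂
      refine ⟨ρ₁.act t k, ρ₂.act t k, V.act t k, p.act t k, ?_, ih₂, by simp [URel.actRun, URel.Val.act_merge]⟩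
      simpa [URel.actRun, URel.Point.dual_act] using ih₁
  | _, _, _, _, .mpx S j h hS hj hΓ' hM', hrk, r, hr => by
      obtain ⟨ρ, p, hm, rfl⟩ := hr
      have hr' : h.rank ≤ t := le_trans (le_max_right _ _) hrk
      have hS' : S.card ≤ t := le_trans (le_max_left _ _) hrk
      exact ⟨_, _, act_mem_interp hk ht₁ h hr' hm, by simp [URel.actRun, URel.act_mpxVal k hS']⟩
  | _, _, _, _, .sp (Γ := Γ) (k := k') h hΓ', hrk, r, hr => by
      obtain ⟨R, hR, rfl⟩ := hr
      have ih : ∀ x ∈ R, URel.actRun t k x ∈ URel.liftArg k' Γ h.interp := fun x hx =>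
        URel.actRun_mem_liftArg ht₁ (fun r hr => act_mem_interp hk ht₁ h hrk hr) k' Γ x (hR x hx)
      by_cases hc : Multiset.card R ≤ t
      · refine ⟨R.map (URel.actRun t k), fun x hx => ?_, ?_⟩
        · obtain ⟨y, hy, rfl⟩ := Multiset.mem_map.1 hx
          exact ih y hy
        · simp only [URel.actRun, Prod.mk.injEq]
          refine ⟨URel.act_spVal_of_le k Γ hc, ?_⟩
          rw [URel.Point.act_ofCourse, Multiset.map_map, Multiset.map_map,
            URel.mbump_of_card_le (by rwa [Multiset.card_map])]
          rfl
      · refine ⟨k • R.map (URel.actRun t k), fun x hx => ?_, ?_⟩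
        · obtain ⟨y, hy, rfl⟩ := Multiset.mem_map.1 (Multiset.mem_nsmul.1 hx).2
          exact ih y hy
        · simp only [URel.actRun, Prod.mk.injEq]
          refine ⟨URel.act_spVal_of_lt k Γ (Nat.not_le.1 hc), ?_⟩
          rw [URel.Point.act_ofCourse, Multiset.map_map, Multiset.map_nsmul, Multiset.map_map,
            URel.mbump_of_lt (by rw [Multiset.card_map]; exact Nat.not_le.1 hc)]
          rfl
  | _, _, _, _, .allI h hΔ, hrk, r, hr => act_mem_interp hk ht₁ h hrk hr
  | _, _, _, _, .allE A h, hrk, r, hr => act_mem_interp hk ht₁ h hrk hr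
  | _, _, _, _, .sum h₁ h₂, hrk, r, hr => by
      rcases hr with hr | hr
      · exact Or.inl (act_mem_interp hk ht₁ h₁ (le_trans (le_max_left _ _) hrk) hr)
      · exact Or.inr (act_mem_interp hk ht₁ h₂ (le_trans (le_max_right _ _) hrk) hr)

/-- The results of a derivation form a `t`-obsessional clique for every `t ≥ max 1 rk(Π)`.
[cite: LaurentTortoraDeFalco2006, Prop. 8] -/
theorem isObsessional_results {d : ℕ} {Γ : Ctx} {M : Term} {σ : SoftTy} (D : Deriv d Γ M σ) {t : ℕ}
    (ht : max 1 D.rank ≤ t) : URel.IsObsessional t D.results := by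
  rintro p ⟨ρ, hρ⟩ k hk
  exact ⟨ρ.act t k, act_mem_interp hk (le_trans (le_max_left _ _) ht) D (le_trans (le_max_right _ _) ht) hρ⟩

/-- The results of a derivation are obsessional from `max 1 rk(Π)`. [cite: LaurentTortoraDeFalco2006, Prop. 8] -/
theorem obsessionalFrom_results {d : ℕ} {Γ : Ctx} {M : Term} {σ : SoftTy} (D : Deriv d Γ M σ) :
    URel.ObsessionalFrom (max 1 D.rank) D.results :=
  fun _ ht => D.isObsessional_results ht

end STA.Deriv

/-- **Softness of the interpretation of soft programs** (LTdF Prop. 8 for this reading of STA derivations): the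
interpretation of a closed derivation `Π` of `STA₊` is obsessional from `max 1 rk(Π)` — closed under the
`t`-action of `ℕ*` for every `t` at least the multiplexing rank of `Π` (and at least `1`). The threshold is the
RANK of the derivation, not its degree/level. [cite: LaurentTortoraDeFalco2006, Prop. 8 (with §2.2)] -/
theorem obsessionalFrom_softProgramInterpretation {d : ℕ} {M : STA.Term} {σ : STA.SoftTy}
    (D : STA.Deriv d STA.Ctx.empty M σ) :
    URel.ObsessionalFrom (max 1 D.rank) (SoftProgramInterpretation D) :=
  D.obsessionalFrom_results

/-- `t`-obsessionality of the interpretation of a closed derivation for every `t ≥ max 1 rk(Π)`.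
[cite: LaurentTortoraDeFalco2006, Prop. 8 (with §2.2)] -/
theorem isObsessional_softProgramInterpretation {d : ℕ} {M : STA.Term} {σ : STA.SoftTy}
    (D : STA.Deriv d STA.Ctx.empty M σ) {t : ℕ} (ht : max 1 D.rank ≤ t) :
    URel.IsObsessional t (SoftProgramInterpretation D) :=
  D.isObsessional_results ht


/-! ### The data: the two booleans, computed -/

namespace STA.Deriv

/-- The premise of `(w)` in the canonical derivation of `0`: `x : α` alone, at slot `1`. [folklore] -/
private theorem zeroD_isSingleton (Γ : Ctx) (hΓ : ∀ i, Γ i = none) :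
    (Ctx.cons none (Ctx.cons (some ⟨0, .tvar 0⟩) Γ.shift)).IsSingleton 1 ⟨0, .tvar 0⟩ := by
  refine ⟨rfl, fun j hj => ?_⟩
  rcases j with _ | _ | j
  · rfl
  · exact (hj rfl).elim
  · simp [Ctx.cons, Ctx.shift, hΓ j]

/-- The context equation of `(w)` in the canonical derivation of `0`. [folklore] -/
private theorem zeroD_update (Γ : Ctx) :
    Ctx.cons (some ⟨0, .tvar 0⟩) (Ctx.cons (some ⟨0, .tvar 0⟩) Γ.shift) =
      Function.update (Ctx.cons none (Ctx.cons (some ⟨0, LinTy.tvar 0⟩) Γ.shift)) 0 (some ⟨0, .tvar 0⟩) := by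
  funext i
  rcases i with _ | _ | j <;> simp [Ctx.cons]

/-- The canonical derivation of `⊢ 0 : B` (`0 = λxy.x`, degree `0`, any assumption-free context): `(Ax)`, `(w)`,
`(⊸I)`, `(⊸I)`, `(∀I)` — the derivation `STA.typing_zero` as data. [cite: GaboardiMarionRonchidellarocca2008, §3.2] -/
def zeroD (Γ : Ctx) (hΓ : ∀ i, Γ i = none) : Deriv 0 Γ zero ⟨0, tyB⟩ :=
  .allI (Δ := Γ.shift)
    (.lam (.lam (.weak (Γ := Ctx.cons none (Ctx.cons (some ⟨0, .tvar 0⟩) Γ.shift)) 0 (.tvar 0)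
      (.ax (zeroD_isSingleton Γ hΓ)) rfl (zeroD_update Γ))))
    rfl

/-- The axiom `y : α ⊢ y : α` of the canonical derivation of `1`, at slot `0`. [folklore] -/
private theorem oneD_isSingleton (Γ : Ctx) (hΓ : ∀ i, Γ i = none) :
    (Ctx.cons (some ⟨0, .tvar 0⟩) (Ctx.cons none Γ.shift)).IsSingleton 0 ⟨0, .tvar 0⟩ := by
  refine ⟨rfl, fun j hj => ?_⟩
  rcases j with _ | _ | j
  · exact (hj rfl).elim
  · rfl
  · simp [Ctx.cons, Ctx.shift, hΓ j]

/-- The context equation of `(w)` in the canonical derivation of `1`. [folklore] -/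
private theorem oneD_update (Γ : Ctx) :
    Ctx.cons (some ⟨0, .tvar 0⟩) Γ.shift =
      Function.update (Ctx.cons none Γ.shift) 0 (some ⟨0, LinTy.tvar 0⟩) := by
  funext i
  rcases i with _ | j <;> simp [Ctx.cons]

/-- The canonical derivation of `⊢ 1 : B` (`1 = λxy.y`): `(Ax)`, `(⊸I)`, `(w)`, `(⊸I)`, `(∀I)` — `STA.typing_one` as
data. [cite: GaboardiMarionRonchidellarocca2008, §3.2] -/
def oneD (Γ : Ctx) (hΓ : ∀ i, Γ i = none) : Deriv 0 Γ one ⟨0, tyB⟩ :=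
  .allI (Δ := Γ.shift)
    (.lam (.weak (Γ := Ctx.cons none Γ.shift) 0 (.tvar 0)
      (.lam (.ax (oneD_isSingleton Γ hΓ))) rfl (oneD_update Γ)))
    rfl

/-- The axiom `x : A ⊢ x : A` at slot `0` over the empty context. [folklore] -/
private theorem idD_isSingleton (A : LinTy) : (Ctx.cons (some ⟨0, A⟩) Ctx.empty).IsSingleton 0 ⟨0, A⟩ :=
  ⟨rfl, fun j hj => by
    rcases j with _ | j
    · exact (hj rfl).elim
    · rfl⟩

/-- The derivation `(Ax)`, `(⊸I)` of the identity `⊢ λx.x : A ⊸ A` (`x` linear).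
[cite: GaboardiMarionRonchidellarocca2008, Table 2] -/
def idD (A : LinTy) : Deriv 0 Ctx.empty (.lam (.var 0)) ⟨0, .limp 0 A A⟩ :=
  .lam (.ax (idD_isSingleton A))

end STA.Deriv

/-- **`⟦⊢ λx.x : A ⊸ A⟧` is the dereliction clique `{?[x̄] ⅋ x | x ∈ D}`** (`URel.derelictionClique`): in the affine
reading a linear hypothesis used once is a box opened once. Hence the threshold `1` of
`obsessionalFrom_softProgramInterpretation` is sharp (`URel.not_obsessionalFrom_zero_derelictionClique`).
[cite: LaurentTortoraDeFalco2006, §2.2] -/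
theorem softProgramInterpretation_idD (A : STA.LinTy) :
    SoftProgramInterpretation (STA.Deriv.idD A) = URel.derelictionClique := by
  ext q
  simp only [SoftProgramInterpretation, STA.Deriv.results, STA.Deriv.idD, STA.Deriv.interp,
    Set.mem_setOf_eq, URel.derelictionClique, Set.mem_range]
  simp [URel.Val.single, URel.bang1, eq_comm, URel.Point.dual_ofCourse]

namespace URel

/-- The point `![a]‾ ⅋ (![]‾ ⅋ a) = ?[ā] ⅋ (?[] ⅋ a)` of `⟦0⟧` with axiom label `a`: `x` used (`![a]`), `y`
discarded (`![]`), result `a` — the relational point `([a], [], a)` of `λxy.x`. [cite: LaurentTortoraDeFalco2006, Def. 12] -/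
noncomputable def zeroPoint (a : Point) : Point := (bang1 a).dual.par (bang0.dual.par a)

/-- The point `?[] ⅋ (?[ā] ⅋ a)` of `⟦1⟧` with axiom label `a` — the relational point `([], [a], a)` of `λxy.y`.
[cite: LaurentTortoraDeFalco2006, Def. 12] -/
noncomputable def onePoint (a : Point) : Point := bang0.dual.par ((bang1 a).dual.par a)

/-- `⟦0⟧ = {?[ā] ⅋ (?[] ⅋ a) | a ∈ D}`: the interpretation of GMR08's boolean `0` ("true", the accepting answer),
see `softProgramInterpretation_zeroD`. [cite: LaurentTortoraDeFalco2006, Def. 12] -/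
def zeroClique : Set Point := Set.range zeroPoint

/-- `⟦1⟧ = {?[] ⅋ (?[ā] ⅋ a) | a ∈ D}`: the interpretation of GMR08's boolean `1` ("false"), see
`softProgramInterpretation_oneD`. [cite: LaurentTortoraDeFalco2006, Def. 12] -/
def oneClique : Set Point := Set.range onePoint

/-- `zeroPoint` with the duals computed: `?[ā] ⅋ (?[] ⅋ a)`. [cite: LaurentTortoraDeFalco2006, §5.1] -/
theorem zeroPoint_eq (a : Point) :
    zeroPoint a = (Point.whyNot {a.dual}).par ((Point.whyNot 0).par a) := by
  simp [zeroPoint, bang1, bang0]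

/-- `onePoint` with the duals computed: `?[] ⅋ (?[ā] ⅋ a)`. [cite: LaurentTortoraDeFalco2006, §5.1] -/
theorem onePoint_eq (a : Point) :
    onePoint a = (Point.whyNot 0).par ((Point.whyNot {a.dual}).par a) := by
  simp [onePoint, bang1, bang0]

/-- `![a] ≠ ![]`. [cite: LaurentTortoraDeFalco2006, §5.1] -/
theorem bang1_ne_bang0 (a : Point) : bang1 a ≠ bang0 :=
  fun h => Multiset.singleton_ne_zero a (Point.ofCourse_injective h)

/-- No point of `⟦0⟧` is a point of `⟦1⟧` (they differ in which argument is discarded).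
[cite: LaurentTortoraDeFalco2006, §5.1] -/
theorem zeroPoint_ne_onePoint (a b : Point) : zeroPoint a ≠ onePoint b := by
  intro h
  have h1 := (Point.par_inj.1 h).1
  have h2 := congrArg Point.dual h1
  rw [Point.dual_dual, Point.dual_dual] at h2
  exact bang1_ne_bang0 a h2

/-- `⟦0⟧` and `⟦1⟧` are DISJOINT (unlike the two Lafont booleans of `CliqueDecides`, which meet).
[cite: LaurentTortoraDeFalco2006, §5.1] -/
theorem disjoint_zeroClique_oneClique : Disjoint zeroClique oneClique :=
  Set.disjoint_left.2 fun _ ⟨a, ha⟩ ⟨b, hb⟩ => zeroPoint_ne_onePoint a b (ha.trans hb.symm)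

/-- `⟦0⟧` is nonempty. [cite: LaurentTortoraDeFalco2006, Remark 2] -/
theorem zeroClique_nonempty : zeroClique.Nonempty := Set.range_nonempty _

/-- `⟦1⟧` is nonempty. [cite: LaurentTortoraDeFalco2006, Remark 2] -/
theorem oneClique_nonempty : oneClique.Nonempty := Set.range_nonempty _

/-- `⟦0⟧ ≠ ⟦1⟧`: the relational model separates the two answers. [cite: LaurentTortoraDeFalco2006, §5.1] -/
theorem zeroClique_ne_oneClique : zeroClique ≠ oneClique := fun h => by
  obtain ⟨x, hx⟩ := zeroClique_nonempty
  exact Set.disjoint_left.1 disjoint_zeroClique_oneClique hx (h ▸ hx)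

end URel

/-- **`⟦⊢ 0 : B⟧ = {?[ā] ⅋ (?[] ⅋ a) | a ∈ D}`** for the canonical derivation of GMR08's boolean `0 = λxy.x`.
[cite: LaurentTortoraDeFalco2006, Def. 12] -/
theorem softProgramInterpretation_zeroD :
    SoftProgramInterpretation (STA.Deriv.zeroD STA.Ctx.empty fun _ => rfl) = URel.zeroClique := by
  ext q
  simp only [SoftProgramInterpretation, STA.Deriv.results, STA.Deriv.zeroD, STA.Deriv.interp,
    Set.mem_setOf_eq, URel.zeroClique, Set.mem_range, URel.zeroPoint]
  simp [URel.Val.unshift, URel.Val.single, eq_comm]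

/-- **`⟦⊢ 1 : B⟧ = {?[] ⅋ (?[ā] ⅋ a) | a ∈ D}`** for the canonical derivation of GMR08's boolean `1 = λxy.y`.
[cite: LaurentTortoraDeFalco2006, Def. 12] -/
theorem softProgramInterpretation_oneD :
    SoftProgramInterpretation (STA.Deriv.oneD STA.Ctx.empty fun _ => rfl) = URel.oneClique := by
  ext q
  simp only [SoftProgramInterpretation, STA.Deriv.results, STA.Deriv.oneD, STA.Deriv.interp,
    Set.mem_setOf_eq, URel.oneClique, Set.mem_range, URel.onePoint]
  simp [URel.Val.single, eq_comm]

/-! ### The STA-native word→boolean interface -/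

namespace URel

/-- The `≤ 1`-box of a clique of results: `{![a] | a ∈ A} ∪ {![]}` — the labels a LINEAR argument net with results
`A` offers to a function (one copy or none; convention of this file). [cite: LaurentTortoraDeFalco2006, Def. 12] -/
def liftClique (A : Set Point) : Set Point := insert bang0 (bang1 '' A)

/-- Semantic (functorial) promotion of a closed clique: `!B = {![y₁, …, y_j] | j ≥ 0, yᵢ ∈ B}` — the results of a box
around a closed net with results `B` (box clause of Def. 12 with no auxiliary door; `! = M_f` in `REL`).
[cite: LaurentTortoraDeFalco2006, Def. 12 and §2.2] -/
def bangClique (B : Set Point) : Set Point := {x | ∃ m : Multiset Point, (∀ y ∈ m, y ∈ B) ∧ x = Point.ofCourse m}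

/-- The labels offered by an argument of type `!ⁿ S` built from a closed datum with results `A` by `n` promotions
(`(sp)ⁿ`, the innermost over the linear type `S`): `!ⁿ` of the `≤ 1`-box of `A` (`n = 0`: the `≤ 1`-box itself).
See `STA.Deriv.results_appArg` for the fact that this IS what the applied derivation consumes.
[cite: LaurentTortoraDeFalco2006, Def. 12] -/
def argClique (n : ℕ) (A : Set Point) : Set Point := bangClique^[n] (liftClique A)

/-- **Semantic application of a program clique** `c` (type `!ⁿ S ⊸ B`: points `V̄ ⅋ b`) to a closed argument with
results `A`, promoted `n` times: the results `b` such that `V̄ ⅋ b ∈ c` for some label `V ∈ argClique n A` — the cut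
clause of Def. 12 (dual labels on the two premisses of the cut). [cite: LaurentTortoraDeFalco2006, Def. 12] -/
def progApply (n : ℕ) (c A : Set Point) : Set Point := {b | ∃ V ∈ argClique n A, (Point.dual V).par b ∈ c}

/-- **`STADecides n m c L`** — the STA-native analogue of `URel.CliqueDecides`: the clique `c ⊆ D`, of the type of
programs `!ⁿ S_m ⊸ B`, decides `L ⊆ {0,1}*` at the word→boolean interface of GMR08's data: for every word `w` and
every derivation `Π_w ▹ ⊢ w̲ : S_m` of its code, applying `c` to `⟦Π_w⟧` promoted `n` times yields exactly `⟦0⟧`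
(GMR08's accepting answer, `STA.DecidesByZero`) if `w ∈ L` and exactly `⟦1⟧` if `w ∉ L`. Interface notion of the
route PneNP/LightLogic assembled from GMR08 Def. 3.8 (shape of programs and acceptance) and LTdF Def. 12 (cut);
not printed in either. [folklore] -/
def STADecides (n m : ℕ) (c : Set Point) (L : Language Bool) : Prop :=
  ∀ (w : List Bool) (d : ℕ) (D : STA.Deriv d STA.Ctx.empty (STA.encWord w) ⟨0, STA.tyS m⟩),
    (w ∈ L → progApply n c (SoftProgramInterpretation D) = zeroClique) ∧
    (w ∉ L → progApply n c (SoftProgramInterpretation D) = oneClique)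

/-- Membership in the `≤ 1`-box clique. [cite: LaurentTortoraDeFalco2006, Def. 12] -/
@[simp] theorem mem_liftClique {A : Set Point} {x : Point} :
    x ∈ liftClique A ↔ x = bang0 ∨ ∃ a ∈ A, bang1 a = x := by
  simp [liftClique, Set.mem_insert_iff, Set.mem_image]

/-- Membership in a promoted clique. [cite: LaurentTortoraDeFalco2006, Def. 12] -/
@[simp] theorem mem_bangClique {B : Set Point} {x : Point} :
    x ∈ bangClique B ↔ ∃ m : Multiset Point, (∀ y ∈ m, y ∈ B) ∧ x = Point.ofCourse m := Iff.rfl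

/-- `argClique 0 A` is the `≤ 1`-box. [cite: LaurentTortoraDeFalco2006, Def. 12] -/
@[simp] theorem argClique_zero (A : Set Point) : argClique 0 A = liftClique A := rfl

/-- `argClique (n+1) A = !(argClique n A)`. [cite: LaurentTortoraDeFalco2006, Def. 12] -/
theorem argClique_succ (n : ℕ) (A : Set Point) : argClique (n + 1) A = bangClique (argClique n A) :=
  Function.iterate_succ_apply' _ _ _

/-- Membership in `progApply` (definitional unfolding). [cite: LaurentTortoraDeFalco2006, Def. 12] -/
@[simp] theorem mem_progApply {n : ℕ} {c A : Set Point} {b : Point} :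
    b ∈ progApply n c A ↔ ∃ V ∈ argClique n A, (Point.dual V).par b ∈ c := Iff.rfl

/-- `progApply` is monotone in both cliques. [cite: LaurentTortoraDeFalco2006, Def. 12] -/
theorem progApply_mono {n : ℕ} {c c' A A' : Set Point} (hc : c ⊆ c') (hA : A ⊆ A') :
    progApply n c A ⊆ progApply n c' A' := by
  have hlift : liftClique A ⊆ liftClique A' := by
    intro x hx
    rcases mem_liftClique.1 hx with rfl | ⟨a, ha, rfl⟩
    · exact mem_liftClique.2 (Or.inl rfl)
    · exact mem_liftClique.2 (Or.inr ⟨a, hA ha, rfl⟩)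
  have hbang : ∀ {B B' : Set Point}, B ⊆ B' → bangClique B ⊆ bangClique B' :=
    fun h _ ⟨m, hm, hx⟩ => ⟨m, fun y hy => h (hm y hy), hx⟩
  have harg : ∀ k, argClique k A ⊆ argClique k A' := by
    intro k
    induction k with
    | zero => exact hlift
    | succ k ih => rw [argClique_succ, argClique_succ]; exact hbang ih
  rintro b ⟨V, hV, hb⟩
  exact ⟨V, harg n hV, hc hb⟩

/-- A clique decides at most one language at the STA interface (`m ≥ 1`, so that every word has a derivation
`⊢ w̲ : S_m`, `STA.typing_encWord_level`). [folklore] -/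
theorem STADecides.unique {n m : ℕ} (hm : 1 ≤ m) {c : Set Point} {L L' : Language Bool}
    (h : STADecides n m c L) (h' : STADecides n m c L') : L = L' := by
  ext w
  obtain ⟨D⟩ := (STA.typing_encWord_level w m hm).nonempty_deriv
  by_contra hw
  rcases not_iff.1 hw |>.symm |> iff_iff_and_or_not_and_not.1 with ⟨h1, h2⟩ | ⟨h1, h2⟩
  · exact zeroClique_ne_oneClique (((h' w _ D).1 h1).symm.trans ((h w _ D).2 h2))
  · exact zeroClique_ne_oneClique (((h w _ D).1 (not_not.1 h2)).symm.trans ((h' w _ D).2 h1))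

/-- The language decided by a deciding clique, read off the interface (`m ≥ 1`). [folklore] -/
theorem STADecides.mem_iff {n m : ℕ} (hm : 1 ≤ m) {c : Set Point} {L : Language Bool}
    (h : STADecides n m c L) (w : List Bool) :
    w ∈ L ↔ ∀ (d : ℕ) (D : STA.Deriv d STA.Ctx.empty (STA.encWord w) ⟨0, STA.tyS m⟩),
      progApply n c (SoftProgramInterpretation D) = zeroClique := by
  refine ⟨fun hw d D => (h w d D).1 hw, fun hw => by_contra fun hn => ?_⟩
  obtain ⟨D⟩ := (STA.typing_encWord_level w m hm).nonempty_deriv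
  exact zeroClique_ne_oneClique ((hw 0 D).symm.trans ((h w 0 D).2 hn))

/-- `t`-obsessional cliques have `t`-obsessional `≤ 1`-boxes for `t ≥ 1`. [cite: LaurentTortoraDeFalco2006, §2.2] -/
theorem IsObsessional.liftClique {t : ℕ} (ht : 1 ≤ t) {A : Set Point} (hA : IsObsessional t A) :
    IsObsessional t (liftClique A) := by
  intro x hx k hk
  rcases mem_liftClique.1 hx with rfl | ⟨a, ha, rfl⟩
  · rw [act_bang0]; exact mem_liftClique.2 (Or.inl rfl)
  · rw [act_bang1 ht]; exact mem_liftClique.2 (Or.inr ⟨_, hA ha hk, rfl⟩)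

/-- **Promotion preserves obsessionality** (LTdF §2.2: `!x` is obsessional for any `t`).
[cite: LaurentTortoraDeFalco2006, §2.2] -/
theorem IsObsessional.bangClique {t : ℕ} {B : Set Point} (hB : IsObsessional t B) :
    IsObsessional t (bangClique B) := by
  rintro x ⟨m, hm, rfl⟩ k hk
  rw [Point.act_ofCourse]
  refine ⟨mbump t k (m.map (Point.act t k)), fun y hy => ?_, rfl⟩
  have hy' : y ∈ m.map (Point.act t k) := by
    unfold mbump at hy
    split_ifs at hy
    · exact hy
    · exact (Multiset.mem_nsmul.1 hy).2
  obtain ⟨z, hz, rfl⟩ := Multiset.mem_map.1 hy'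
  exact hB (hm z hz) hk

/-- The argument cliques of an obsessional datum are obsessional (`t ≥ 1`). [cite: LaurentTortoraDeFalco2006, §2.2] -/
theorem IsObsessional.argClique {t : ℕ} (ht : 1 ≤ t) {A : Set Point} (hA : IsObsessional t A) (n : ℕ) :
    IsObsessional t (argClique n A) := by
  induction n with
  | zero => exact hA.liftClique ht
  | succ n ih => rw [argClique_succ]; exact ih.bangClique

/-- **Obsessional cliques are closed under semantic application** (the untyped shadow of LTdF Prop. 1 at the
program type): applying a `t`-obsessional program clique to a `t`-obsessional datum gives a `t`-obsessional
clique of answers (`t ≥ 1`). [cite: LaurentTortoraDeFalco2006, Prop. 1] -/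
theorem IsObsessional.progApply {t : ℕ} (ht : 1 ≤ t) {n : ℕ} {c A : Set Point} (hc : IsObsessional t c)
    (hA : IsObsessional t A) : IsObsessional t (progApply n c A) := by
  rintro b ⟨V, hV, hb⟩ k hk
  refine ⟨V.act t k, hA.argClique ht n hV hk, ?_⟩
  simpa [Point.dual_act] using hc hb hk

end URel

/-! ### Semantic application is the cut against the promoted argument -/

namespace STA.Deriv

/-- `Ctx.empty = Ctx.empty.bang`. [folklore] -/
private theorem empty_eq_bang : Ctx.empty = Ctx.empty.bang := by
  funext i; rfl

/-- The trivial split of the empty context. [folklore] -/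
theorem split_empty : Ctx.empty.Split Ctx.empty Ctx.empty := fun _ => Or.inl ⟨rfl, rfl⟩

/-- `n` promotions `(sp)ⁿ` of a closed derivation of a linear type: `⊢ N : A` of degree `d` becomes `⊢ N : !ⁿ A`
of degree `d + n` (as the input word of a program is promoted, `STA.typing_app_encWord`).
[cite: GaboardiMarionRonchidellarocca2008, Table 2 (sp)] -/
def spPow {d : ℕ} {N : Term} {A : LinTy} (D : Deriv d Ctx.empty N ⟨0, A⟩) :
    (n : ℕ) → Deriv (d + n) Ctx.empty N ⟨n, A⟩
  | 0 => D
  | n + 1 => .sp (spPow D n) empty_eq_bang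

/-- The applied program `⊢ M N : B` of degree `max d (d' + n)`: `(⊸E)` of a program derivation
`⊢ M : !ⁿ S_m ⊸ B` against the `n`-fold promoted argument. [cite: GaboardiMarionRonchidellarocca2008, Table 2 (⊸E)] -/
def appArg {d d' n m : ℕ} {M N : Term} (DM : Deriv d Ctx.empty M (progTy n m))
    (DN : Deriv d' Ctx.empty N ⟨0, tyS m⟩) : Deriv (max d (d' + n)) Ctx.empty (.app M N) ⟨0, tyB⟩ :=
  .app split_empty DM (DN.spPow n)

/-- The labels consumed from the `n`-fold promoted closed argument are exactly `argClique n` of its results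
(LTdF Def. 12, box clause iterated, with the `≤ 1`-box at the bottom). [cite: LaurentTortoraDeFalco2006, Def. 12] -/
theorem snd_mem_liftArg_spPow_iff {d : ℕ} {N : Term} {A : LinTy} (D : Deriv d Ctx.empty N ⟨0, A⟩) :
    ∀ (n : ℕ) (V : URel.Point),
      (∃ ρ, (ρ, V) ∈ URel.liftArg n Ctx.empty (D.spPow n).interp) ↔ V ∈ URel.argClique n D.results
  | 0, V => by
      simp only [spPow, URel.liftArg, Set.mem_setOf_eq, URel.argClique_zero, URel.mem_liftClique, results]
      constructor
      · rintro ⟨ρ, ⟨ρ', b, hb, h⟩ | h⟩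
        · cases h
          exact Or.inr ⟨b, ⟨_, hb⟩, rfl⟩
        · cases h
          exact Or.inl rfl
      · rintro (rfl | ⟨a, ⟨ρ, ha⟩, rfl⟩)
        · exact ⟨_, Or.inr rfl⟩
        · exact ⟨ρ, Or.inl ⟨ρ, a, ha, rfl⟩⟩
  | n + 1, V => by
      rw [URel.argClique_succ]
      simp only [spPow, URel.liftArg, interp, Set.mem_setOf_eq, Prod.mk.injEq, URel.mem_bangClique]
      constructor
      · rintro ⟨ρ, R, hR, -, rfl⟩
        refine ⟨R.map Prod.snd, fun y hy => ?_, rfl⟩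
        obtain ⟨x, hx, rfl⟩ := Multiset.mem_map.1 hy
        exact (snd_mem_liftArg_spPow_iff D n x.2).1 ⟨x.1, hR x hx⟩
      · rintro ⟨m, hm, rfl⟩
        classical
        let g : URel.Point → URel.Val := fun y =>
          if h : ∃ ρ, (ρ, y) ∈ URel.liftArg n Ctx.empty (D.spPow n).interp then h.choose else fun _ => none
        have hg : ∀ y ∈ m, (g y, y) ∈ URel.liftArg n Ctx.empty (D.spPow n).interp := fun y hy => by
          have h := (snd_mem_liftArg_spPow_iff D n y).2 (hm y hy)
          simp only [g, dif_pos h]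
          exact h.choose_spec
        refine ⟨_, m.map fun y => (g y, y), fun x hx => ?_, rfl, by rw [Multiset.map_map]; simp⟩
        obtain ⟨y, hy, rfl⟩ := Multiset.mem_map.1 hx
        exact hg y hy

/-- **Semantic application is the cut against the promoted argument**: the results of the applied derivation
`⊢ M N : B` (program `Π_M ▹ ⊢ M : !ⁿ S_m ⊸ B`, argument `Π_N ▹ ⊢ N : S_m` promoted `n` times) are
`progApply n ⟦Π_M⟧ ⟦Π_N⟧` — the cut and box clauses of LTdF Def. 12 unfolded. [cite: LaurentTortoraDeFalco2006, Def. 12] -/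
theorem results_appArg {d d' n m : ℕ} {M N : Term} (DM : Deriv d Ctx.empty M (progTy n m))
    (DN : Deriv d' Ctx.empty N ⟨0, tyS m⟩) :
    SoftProgramInterpretation (appArg DM DN) =
      URel.progApply n (SoftProgramInterpretation DM) (SoftProgramInterpretation DN) := by
  ext b
  simp only [SoftProgramInterpretation, results, appArg, interp, Set.mem_setOf_eq, Prod.mk.injEq,
    URel.mem_progApply]
  constructor
  · rintro ⟨ρ, ρ₁, ρ₂, V, p, h₁, h₂, -, rfl⟩
    exact ⟨V, (snd_mem_liftArg_spPow_iff DN n V).1 ⟨ρ₂, h₂⟩, ρ₁, h₁⟩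
  · rintro ⟨V, hV, ρ₁, h₁⟩
    obtain ⟨ρ₂, h₂⟩ := (snd_mem_liftArg_spPow_iff DN n V).2 hV
    exact ⟨_, ρ₁, ρ₂, V, b, h₁, h₂, rfl, rfl⟩

end STA.Deriv


/-! ### Support of valuations; the programs of `SoftRepresentsAtLevel` -/

/-- The `≤ 1`-box keeps valuations supported on the context. [cite: LaurentTortoraDeFalco2006, Def. 12] -/
theorem URel.isSome_of_mem_liftArg {S : Set (URel.Val × URel.Point)} {Γ : STA.Ctx}
    (hS : ∀ (ρ : URel.Val) (p : URel.Point), (ρ, p) ∈ S → ∀ i, (ρ i).isSome = (Γ i).isSome) :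
    ∀ (n : ℕ) {ρ : URel.Val} {V : URel.Point}, (ρ, V) ∈ URel.liftArg n Γ S → ∀ i, (ρ i).isSome = (Γ i).isSome
  | 0, ρ, V, hr, i => by
      rcases hr with ⟨ρ', b, hb, he⟩ | he
      · cases he
        exact hS _ _ hb i
      · cases he
        simp only [URel.Val.discard]
        cases Γ i <;> simp
  | _ + 1, _, _, hr, i => hS _ _ hr i

namespace STA.Deriv

/-- **Valuations live exactly on the context**: in every run of `⟦Π⟧`, slot `i` carries a label iff `x_i` is a
hypothesis of `Γ` (every rule labels the slots it introduces and only those). In particular the runs of a CLOSED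
derivation have the empty valuation, so `SoftProgramInterpretation Π` loses nothing.
[cite: LaurentTortoraDeFalco2006, Def. 12] -/
theorem isSome_of_mem_interp :
    {d : ℕ} → {Γ : Ctx} → {M : Term} → {σ : SoftTy} → (D : Deriv d Γ M σ) →
      ∀ {ρ : URel.Val} {p : URel.Point}, (ρ, p) ∈ D.interp → ∀ i, (ρ i).isSome = (Γ i).isSome
  | _, _, _, _, .ax (Γ := Γ) (i := i) h, ρ, p, hr, j => by
      obtain ⟨a, ha⟩ := hr
      cases ha
      by_cases hj : j = i
      · subst hj; simp [URel.Val.single, h.1]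
      · simp [URel.Val.single, hj, h.2 j hj]
  | _, _, _, _, .weak j A h hj hΓ', ρ, p, hr, i => by
      obtain ⟨ρ', p', hm, he⟩ := hr
      cases he; subst hΓ'
      by_cases hi : i = j
      · subst hi; simp
      · simpa [Function.update_of_ne hi] using isSome_of_mem_interp h hm i
  | _, _, _, _, .lam h, ρ, p, hr, i => by
      obtain ⟨ρ', p', V, hm, -, he⟩ := hr
      cases he
      simpa [URel.Val.unshift, Ctx.cons] using isSome_of_mem_interp h hm (i + 1)
  | _, _, _, _, .app (Γ := Γ) (Γ₁ := Γ₁) (Γ₂ := Γ₂) (k := k) hs h₁ h₂, ρ, p, hr, i => by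
      obtain ⟨ρ₁, ρ₂, V, p', hm₁, hm₂, he⟩ := hr
      cases he
      have e₁ := isSome_of_mem_interp h₁ hm₁ i
      have e₂ : (ρ₂ i).isSome = (Γ₂ i).isSome :=
        URel.isSome_of_mem_liftArg (fun ρ p hm => isSome_of_mem_interp h₂ hm) k hm₂ i
      simp only [URel.Val.merge]
      rcases hs i with ⟨hΓ₁, hΓ₂⟩ | ⟨hΓ₁, hΓ₂⟩
      · rw [hΓ₁] at e₁
        rw [hΓ₂] at e₂
        revert e₁ e₂
        cases ρ₁ i <;> cases ρ₂ i <;> simp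
      · rw [hΓ₁] at e₁
        rw [hΓ₂] at e₂
        revert e₁ e₂
        cases ρ₁ i <;> cases ρ₂ i <;> simp
  | _, _, _, _, .mpx S j h hS hj hΓ' hM', ρ, p, hr, i => by
      obtain ⟨ρ', p', hm, he⟩ := hr
      cases he; subst hΓ'
      simp only [URel.mpxVal, Ctx.mpx]
      split_ifs with h1 h2
      · rfl
      · rfl
      · exact isSome_of_mem_interp h hm i
  | _, _, _, _, .sp (Γ := Γ) h hΓ', ρ, p, hr, i => by
      obtain ⟨R, -, he⟩ := hr
      cases he; subst hΓ'
      simp only [URel.spVal, Ctx.bang]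
      split_ifs with h1 <;> simp [h1]
      cases hΓ : Γ i with
      | none => exact (h1 hΓ).elim
      | some _ => rfl
  | _, _, _, _, .allI (Γ := Γ) h hΔ, ρ, p, hr, i => by
      have e := isSome_of_mem_interp h hr i
      rw [hΔ] at e
      simpa [Ctx.shift] using e
  | _, _, _, _, .allE A h, ρ, p, hr, i => isSome_of_mem_interp h hr i
  | _, _, _, _, .sum h₁ h₂, ρ, p, hr, i => by
      rcases hr with hr | hr
      · exact isSome_of_mem_interp h₁ hr i
      · exact isSome_of_mem_interp h₂ hr i

/-- The runs of a closed derivation have the empty valuation. [cite: LaurentTortoraDeFalco2006, Def. 12] -/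
theorem eq_none_of_mem_interp {d : ℕ} {M : Term} {σ : SoftTy} (D : Deriv d Ctx.empty M σ)
    {ρ : URel.Val} {p : URel.Point} (h : (ρ, p) ∈ D.interp) : ρ = fun _ => none := by
  funext i
  have := D.isSome_of_mem_interp h i
  revert this
  cases ρ i <;> simp [Ctx.empty]

/-- For a closed derivation, `⟦Π⟧ = {∅} × SoftProgramInterpretation Π`: the interpretation IS its set of results.
[cite: LaurentTortoraDeFalco2006, Def. 12] -/
theorem mem_interp_iff_of_closed {d : ℕ} {M : Term} {σ : SoftTy} (D : Deriv d Ctx.empty M σ)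
    (ρ : URel.Val) (p : URel.Point) :
    (ρ, p) ∈ D.interp ↔ (ρ = fun _ => none) ∧ p ∈ SoftProgramInterpretation D :=
  ⟨fun h => ⟨D.eq_none_of_mem_interp h, ρ, h⟩, fun ⟨hρ, ρ', h'⟩ => by
    rw [hρ, ← D.eq_none_of_mem_interp h']; exact h'⟩

end STA.Deriv

/-- The programs quantified over by `SoftRepresentsAtLevel t L` HAVE interpretations: a closed sum-free program
`⊢ M : !ⁿ S_m ⊸ B` of level `≤ t` deciding `L`, together with a derivation `Π` (hence the clique
`SoftProgramInterpretation Π`, obsessional from `max 1 rk(Π)` by `obsessionalFrom_softProgramInterpretation`).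
[cite: GaboardiMarionRonchidellarocca2008, Def. 3.8] -/
theorem SoftRepresentsAtLevel.exists_deriv {t : ℕ} {L : Language Bool} (h : SoftRepresentsAtLevel t L) :
    ∃ (M : STA.Term) (d n m : ℕ) (_ : STA.Deriv d STA.Ctx.empty M (STA.progTy n m)),
      M.SumFree ∧ d ≤ t ∧ n ≤ t ∧ 1 ≤ m ∧ STA.DecidesByZero M L := by
  obtain ⟨M, d, n, m, hM, hd, hn, hm, hT, hL⟩ := h
  obtain ⟨D⟩ := hT.nonempty_deriv
  exact ⟨M, d, n, m, D, hM, hd, hn, hm, hL⟩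

/-- Same for the nondeterministic calculus `STA₊` (`SoftSumRepresentsAtLevel`).
[cite: GaboardiMarionRonchidellarocca2008, Def. 5.13] -/
theorem SoftSumRepresentsAtLevel.exists_deriv {t : ℕ} {L : Language Bool} (h : SoftSumRepresentsAtLevel t L) :
    ∃ (M : STA.Term) (d n m : ℕ) (_ : STA.Deriv d STA.Ctx.empty M (STA.progTy n m)),
      d ≤ t ∧ n ≤ t ∧ 1 ≤ m ∧ STA.DecidesByZero M L := by
  obtain ⟨M, d, n, m, hd, hn, hm, hT, hL⟩ := h
  obtain ⟨D⟩ := hT.nonempty_deriv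
  exact ⟨M, d, n, m, D, hd, hn, hm, hL⟩

end Literature.Computability.ImplicitComplexity
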